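import Mathlib
import Summits.NavierStokesRegularity.NavierStokesRegularity.Theses.IsobarTomography
import Literature.Analysis.FluidPDE.Vorticity

/-!
# Sketch — crux-ideate, ideator 1, crux `IsobaricLinesLiouville` (stmt-NavierStokesRegularity-11741)

First lemmas of the two idea cards, stated over existing declarations, plus the kernel-checked
reduction `isobaricLinesLiouville_of_normalForm` (card `overdetermined-isobaric-rigidity`):
`IsobaricNormalForm → IrrotationalLeaf → HarmonicPressureLeaf → TranslationLeaf → RotationScrewLeaf →
IsobaricLinesLiouville`.

Nothing here is a proof of the crux; the `def … : Prop` are the typed statements the cards refer to.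
-/

noncomputable section

open MeasureTheory Set Function Filter
open scoped ContDiff Laplacian InnerProductSpace RealInnerProductSpace Topology

namespace Summit.NavierStokesRegularity.NavierStokesRegularity.Cruxes.IsobaricLinesLiouville.Ideator1

open Literature.Analysis.FluidPDE

local notation "ℝ³" => EuclideanSpace ℝ (Fin 3)

/-! ## The class of the crux (abbreviations only) -/

/-- `(v, q)` is an element of the crux's class: bounded ancient mild (`ν = 1`), classical on `t < 0`,
with isobaric vortex lines `ω · ∇q ≡ 0`. -/
def InClass (v : ℝ → ℝ³ → ℝ³) (q : ℝ → ℝ³ → ℝ) : Prop :=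
  IsBoundedAncientMildSolution 1 v ∧ IsClassicalNSSolutionOn (Iio 0) 1 0 v q ∧
    ∀ t < 0, ∀ x : ℝ³, ⟪curl (v t) x, gradient (q t) x⟫ = 0

/-- Slice-wise constancy, the crux's conclusion. -/
def SliceConst (v : ℝ → ℝ³ → ℝ³) : Prop := ∀ t < 0, ∃ b : ℝ³, v t = fun _ => b

/-- The crux, restated verbatim through the abbreviations (definitionally the route decl). -/
theorem crux_iff :
    Theses.IsobarTomography.IsobaricLinesLiouville ↔ ∀ v q, InClass v q → SliceConst v := by
  constructor
  · intro h v q ⟨h1, h2, h3⟩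
    exact h v q h1 h2 h3
  · intro h v q h1 h2 h3
    exact h v q ⟨h1, h2, h3⟩

/-! ## Card 1 (`overdetermined-isobaric-rigidity`): first lemmas and the reduction -/

/-- **(T) Twist identity — the pressure-blind projection of momentum on vorticity.**
For a classical solution and a point where `ω · ∇q = 0`:
`⟪ω, ∂ₜv⟫ + ⟪ω, ∇(|v|²/2)⟫ + ν ⟪ω, curl ω⟫ = 0` (dot the Lamb form
`∂ₜv + ω × v + ∇(q + |v|²/2) = -ν curl ω` with `ω`). Steady case: the twist density `ω · curl ω` is an exact
`ω`-derivative of the bounded function `-|v|²/2`. Provable now (S–M). -/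
def TwistIdentity : Prop :=
  ∀ (S : Set ℝ) (ν : ℝ) (v : ℝ → ℝ³ → ℝ³) (q : ℝ → ℝ³ → ℝ), IsOpen S →
    IsClassicalNSSolutionOn S ν 0 v q → ∀ t ∈ S, ∀ x : ℝ³,
      ⟪curl (v t) x, gradient (q t) x⟫ = 0 →
        ⟪curl (v t) x, timeDerivWithin S v t x⟫
          + ⟪curl (v t) x, gradient (fun y => ‖v t y‖ ^ 2 / 2) x⟫
          + ν * ⟪curl (v t) x, curl (curl (v t)) x⟫ = 0

/-- **(P) Prolongation identity — isobaricity is not propagated (FIRST LEMMA of card 1).**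
If `ω · ∇q ≡ 0` on `S × ℝ³` (`S` open) then `ω · ∇(∂ₜq + v · ∇q) = -ν Δω · ∇q` pointwise: applying
`∂ₜ + v·∇ - νΔ` to the identity `ω · ∇q = 0`, the two stretching terms `Sω·∇q` cancel and a NEW
third-order constraint remains (the first storey of the tower of compatibility conditions). Provable now (M). -/
def ProlongationIdentity : Prop :=
  ∀ (S : Set ℝ) (ν : ℝ) (v : ℝ → ℝ³ → ℝ³) (q : ℝ → ℝ³ → ℝ), IsOpen S →
    IsClassicalNSSolutionOn S ν 0 v q →
    (∀ t ∈ S, ∀ x : ℝ³, ⟪curl (v t) x, gradient (q t) x⟫ = 0) →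
      ∀ t ∈ S, ∀ x : ℝ³,
        ⟪curl (v t) x,
            gradient (fun y => timeDerivWithin S q t y + ⟪v t y, gradient (q t) y⟫) x⟫
          + ν * ⟪(Δ (curl (v t))) x, gradient (q t) x⟫ = 0

/-- The rotation-or-screw Killing field with axis through `c`, direction `e`, pitch `h`:
`K(x) = h • e + e × (x - c)` (`h = 0`: rotation; `h ≠ 0`: screw). -/
def screwField (c e : ℝ³) (h : ℝ) (x : ℝ³) : ℝ³ := h • e + cross e (x - c)

/-- **IsobaricNormalForm (the bet; conjectural, L–XL).** Every element of the class lies in one of FOUR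
leaves: (I) irrotational slices; (HP) harmonic pressure `Δq ≡ 0` (⇔ `|S|² ≡ |ω|²/2` ⇔ affine pressure;
pressureless flows); (T) invariance under one translation, `(a·∇)v ≡ 0` (planar, 2.5-D, unidirectional,
layered, columnar swirling flows); (RS) invariance under a rotation or screw motion `K` about a (possibly
drifting) axis with the vorticity ALONG `K` (`ω × K = 0`, `L_K v = (K·∇)v - e × v = 0`). Supported by the
prolongation tower (P) and by the formal-jet census of the card (function-of-ONE-variable growth of
isobaric jets at four bases; excess over the planar family FINITE (= 6) at the generic planar base). -/
def IsobaricNormalForm : Prop :=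
  ∀ v q, InClass v q →
    (∀ t < 0, ∀ x : ℝ³, curl (v t) x = 0) ∨
    (∀ t < 0, ∀ x : ℝ³, (Δ (q t)) x = 0) ∨
    (∃ a : ℝ³, a ≠ 0 ∧ ∀ t < 0, ∀ x : ℝ³, fderiv ℝ (v t) x a = 0) ∨
    (∃ (c : ℝ → ℝ³) (e : ℝ³) (h : ℝ), e ≠ 0 ∧ ∀ t < 0, ∀ x : ℝ³,
      cross (curl (v t) x) (screwField (c t) e h x) = 0 ∧
      fderiv ℝ (v t) x (screwField (c t) e h x) = cross e (v t x))

/-- **IrrotationalLeaf (S).** `curl v ≡ 0` and `div v = 0` with `v` bounded ⇒ `v(t)` harmonic bounded ⇒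
constant (the last step of KNSS Thms 5.1–5.2, already in the tree's proofs). -/
def IrrotationalLeaf : Prop :=
  ∀ v q, InClass v q → (∀ t < 0, ∀ x : ℝ³, curl (v t) x = 0) → SliceConst v

/-- **HarmonicPressureLeaf (M–L; the small bet).** Harmonic classical pressure with bounded gradient is
affine, `q = α(t)·x + c(t)`; in the Galilean frame removing `α` the flow is PRESSURELESS,
`∂ₜv + v·∇v = Δv`, every component solves ONE scalar drift–diffusion equation, `|v|²` is a subsolution
and `tr (∇v)² ≡ 0`. Known members (unidirectional, layered) are in leaf (T); why it might fail: a genuinely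
three-dimensional bounded ancient pressureless flow (none known, none found by the seat's layered /
crossed-shear ansätze). -/
def HarmonicPressureLeaf : Prop :=
  ∀ v q, InClass v q → (∀ t < 0, ∀ x : ℝ³, (Δ (q t)) x = 0) → SliceConst v

/-- **TranslationLeaf (M; provable now).** `(a·∇)v ≡ 0` ⇒ `v = (v_h, w)(x_h, t)`, `∇q = ∇_h q̃ + g(t)a`;
the planar part is a bounded ancient mild solution of 2-D NS ⇒ `v_h(t) = b(t)` (KNSS Thm 5.1,
`KNSS2009_liouville_planar_holds` + the slice bridge); then `w` solves `∂ₜw + b·∇w = Δw + g(t)` bounded,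
so in the frame co-moving with `b` the field `∇w` is a bounded ancient caloric field, constant by
`UnboundedOperators.heat_liouville_ancient`, hence `0` (`w` bounded). -/
def TranslationLeaf : Prop :=
  ∀ v q, InClass v q → (∃ a : ℝ³, a ≠ 0 ∧ ∀ t < 0, ∀ x : ℝ³, fderiv ℝ (v t) x a = 0) → SliceConst v

/-- **RotationScrewLeaf (S–M; provable now).** Rotation (`h = 0`): `L_K v = 0` is axisymmetry about the
axis `(c(t), e)` (swirl allowed) and `ω ∥ K` reads `∂ᵣΓ = ∂_zΓ = 0`, so `u_θ = Γ(t)/r`, smooth on the axis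
only if `Γ = 0`: swirl-free ⇒ KNSS Thm 5.2 (`knss_axisymmetric_no_swirl_holds`) after Euclidean/Galilean
normalisation of the axis. Screw (`h ≠ 0`): with `ω = λK`, `ΔK = 0`, `L_K v = 0` the vorticity equation
is `K·(∂ₜ+v·∇-Δ)λ = 2 e × ∇λ`; cross with `K` and use `K·∇λ = 0`: `h‖e‖² ∇λ = 0`, so `λ` is constant and
`|ω| = |λ||K| → ∞` unless `λ = 0`: two lines. -/
def RotationScrewLeaf : Prop :=
  ∀ v q, InClass v q →
    (∃ (c : ℝ → ℝ³) (e : ℝ³) (h : ℝ), e ≠ 0 ∧ ∀ t < 0, ∀ x : ℝ³,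
      cross (curl (v t) x) (screwField (c t) e h x) = 0 ∧
      fderiv ℝ (v t) x (screwField (c t) e h x) = cross e (v t x)) → SliceConst v

/-- **Kernel-checked reduction of card 1:** normal form + the four leaf Liouville theorems give the
crux BY NAME. -/
theorem isobaricLinesLiouville_of_normalForm (hN : IsobaricNormalForm) (hI : IrrotationalLeaf)
    (hH : HarmonicPressureLeaf) (hT : TranslationLeaf) (hR : RotationScrewLeaf) :
    Theses.IsobarTomography.IsobaricLinesLiouville := by
  rw [crux_iff]
  intro v q hvq
  rcases hN v q hvq with h | h | h | h
  · exact hI v q hvq h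
  · exact hH v q hvq h
  · exact hT v q hvq h
  · exact hR v q hvq h

/-! ## Card 2 (`cowling-core-flux`): first lemmas -/

/-- **Viscous Kelvin–Helmholtz law on closed vortex / null lines (FIRST LEMMA of card 2; provable now, M).**
For a classical solution on an open time set and a `C¹` family of closed loops `γ t` each of which
is, at every parameter, tangent to the vorticity or inside its zero set
(`ω(γ) × ∂ₛγ = 0`), the circulation obeys `d/dt ∮_{γ t} v·dl = -ν ∮_{γ t} curl ω · dl`:
the transport term `(∂ₜγ·∇)v·∂ₛγ - (∂ₛγ·∇)v·∂ₜγ = ∂ₜγ·(∂ₛγ × ω)` and the Lamb term `(ω × v)·∂ₛγ` both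
vanish on such loops and `∇(q + |v|²/2)` is exact. This is the momentum-level law the kinematic
(dynamo) analogue lacks. -/
def KelvinOnVortexLines : Prop :=
  ∀ (S : Set ℝ) (ν : ℝ) (v : ℝ → ℝ³ → ℝ³) (q : ℝ → ℝ³ → ℝ), IsOpen S →
    IsClassicalNSSolutionOn S ν 0 v q →
    ∀ (γ : ℝ → ℝ → ℝ³), ContDiffOn ℝ 2 (uncurry γ) (S ×ˢ univ) →
      (∀ t ∈ S, ∀ s, γ t (s + 1) = γ t s) →
      (∀ t ∈ S, ∀ s, cross (curl (v t) (γ t s)) (deriv (γ t) s) = 0) →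
        ∀ t ∈ S, HasDerivAt (fun τ => circulation (v τ) (γ τ))
          (-ν * circulation (curl (curl (v t))) (γ t)) t

/-- **NoEternalSignedCoreCurrent (S after `KelvinOnVortexLines`).** In a BOUNDED ancient flow no
eternal family of closed vortex/null lines of bounded length can carry a one-signed viscous current
`∮ curl ω · dl ≥ c > 0` for all `t ≤ t₀`: the circulation would grow linearly into the past while it
is bounded by `sup |v| · length`. The Cowling neutral-line sign (`∮_core curl ω·t ds > 0` for a
non-degenerately LINKED nest of isobaric tori) is what feeds `c`. -/
def NoEternalSignedCoreCurrent : Prop :=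
  ∀ (v : ℝ → ℝ³ → ℝ³) (q : ℝ → ℝ³ → ℝ), InClass v q →
    ∀ (γ : ℝ → ℝ → ℝ³) (t₀ L c : ℝ), t₀ < 0 → 0 < c →
      ContDiffOn ℝ 2 (uncurry γ) (Iio 0 ×ˢ univ) →
      (∀ t < 0, ∀ s, γ t (s + 1) = γ t s) →
      (∀ t < 0, ∀ s, cross (curl (v t) (γ t s)) (deriv (γ t) s) = 0) →
      (∀ t ≤ t₀, ∫ s in (0 : ℝ)..1, ‖deriv (γ t) s‖ ≤ L) →
      (∀ t ≤ t₀, c ≤ circulation (curl (curl (v t))) (γ t)) → False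

/-- **TwistDivergenceForm (Moffatt–Dormy (6.32) transplanted; S–M).** Pointwise identity valid for
every classical solution (no hypothesis): `ν ω·curl ω + ⟪ω, ∂ₜv⟫ = -div((q + |v|²/2) ω)` (uses
`div ω = 0` and `ω ⊥ ω × v`). Over any compact region bounded by an isobar — a vortex surface in the
class — the twist integral equals `-∫ ⟪ω, ∂ₜv⟫` and VANISHES for steady elements (the divergence
integrates to `∮ (q + |v|²/2) ω·n = 0`); the integral version needs the divergence theorem on
sub-level sets, not in Mathlib. -/
def TwistDivergenceForm : Prop :=
  ∀ (S : Set ℝ) (ν : ℝ) (v : ℝ → ℝ³ → ℝ³) (q : ℝ → ℝ³ → ℝ), IsOpen S →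
    IsClassicalNSSolutionOn S ν 0 v q → ∀ t ∈ S, ∀ x : ℝ³,
      ν * ⟪curl (v t) x, curl (curl (v t)) x⟫ + ⟪curl (v t) x, timeDerivWithin S v t x⟫
        = -VectorCalculus.divergence (fun y => (q t y + ‖v t y‖ ^ 2 / 2) • curl (v t) y) x

end Summit.NavierStokesRegularity.NavierStokesRegularity.Cruxes.IsobaricLinesLiouville.Ideator1
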